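import Literature.MathematicalPhysics.QuantumManyBody.BoseGasThermodynamicLimitProofs
import Literature.MathematicalPhysics.QuantumManyBody.BoseGasThermodynamicLimitRuelle
import Literature.MathematicalPhysics.QuantumManyBody.JelliumBoseGasCondensateDilation
import HarnessLib

/-!
# Route BECBathMassLiouville — `FrozenBathNoBEC` (stmt-AtomisticToContinuum-13803), helper file 4:
# a void in the scatterer configuration makes the quenched ground-state energy small

If an open box `a + (0,s)³`, padded by the range `R₀` of `v`, lies in the cell `[0,L)³` and contains
no scatterer `Yⱼ` (all `Yⱼ ∈ [0,L)³`), then the quenched potential `V_Y = ∑ⱼ v^per(· - Yⱼ)`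
vanishes on `a + (0,s)³` (`quenched_eq_zero_of_void`: a lattice image `Yⱼ + Ln` within distance `R₀`
of the box would lie in `[0,L)³`, forcing `n = 0`), so every Dirichlet trial state of the box
`(0,s)³`, translated to `a` and periodised, is a one-body periodic trial state with quenched energy
equal to its kinetic energy. Hence the quenched ground-state energy is at most the free Dirichlet
energy `E₀(1, s) = s⁻² E₀(1, 1)` (`iInf_quenched_le_of_void`, by `groundStateEnergy_dilate`).

References: LSSY2005 Ch. 2 (Dirichlet states, periodisation); the Lifshitz-tail heuristics of
Sznitman 1998 (the ground state sits in the largest void) motivate the statement.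
-/

noncomputable section

namespace Summit.AtomisticToContinuum.BoseEinsteinCondensation.Theorems.FrozenBath

open MeasureTheory Metric Set Filter
open scoped ENNReal NNReal
open Literature.MathematicalPhysics.QuantumManyBody.BoseGas

variable {L : ℝ}

/-- **No potential in a void.** If the padded box `∏ᵢ (aᵢ - R₀, aᵢ + s + R₀)` lies in `[0,L]³` and
contains no scatterer, then `∑ⱼ v^per(x - Yⱼ) = 0` for every `x ∈ a + (0,s)³` (range `R₀`,
scatterers in the cell): an image `Yⱼ + Ln` within `R₀` of `x` lies in the padded box, inside
`[0,L)³` up to the boundary, so `n = 0` and `Yⱼ` itself would be in the padded box. [folklore] -/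
theorem quenched_eq_zero_of_void {v : ℝ → ℝ≥0∞} {R₀ : ℝ} (hv0 : ∀ r, R₀ < r → v r = 0)
    {M : ℕ} {Y : Config M} (hY : ∀ j, Y j ∈ cell L) {a : Space} {s : ℝ}
    (ha : ∀ i, 0 ≤ a i - R₀) (hb : ∀ i, a i + s + R₀ ≤ L)
    (hempty : ∀ j, ¬ ∀ i, a i - R₀ < Y j i ∧ Y j i < a i + s + R₀)
    {x : Space} (hx : x - a ∈ box s) :
    ∑ j, periodizedPotential v L (x - Y j) = 0 := by
  refine Finset.sum_eq_zero fun j _ => ?_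
  unfold periodizedPotential
  refine ENNReal.tsum_eq_zero.2 fun n => hv0 _ ?_
  by_contra hle
  push Not at hle
  have hcoord : ∀ i, |x i - Y j i - L * n i| ≤ R₀ := fun i => by
    have h := PiLp.norm_apply_le (x - Y j - latticeVec L n) i
    simp only [PiLp.sub_apply, latticeVec, Real.norm_eq_abs] at h
    exact h.trans hle
  have hxa : ∀ i, a i < x i ∧ x i < a i + s := fun i => by
    have h := hx i
    simp only [PiLp.sub_apply, Set.mem_Ioo] at h
    constructor <;> linarith [h.1, h.2]
  -- the image index vanishes
  have hn : ∀ i, n i = 0 := by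
    intro i
    have h := hcoord i
    rw [abs_le] at h
    obtain ⟨hY0, hYL⟩ := hY j i
    obtain ⟨h1, h2⟩ := hxa i
    have hlt : L * (n i : ℝ) < L := by linarith [ha i, hb i]
    have hgt : -L < L * (n i : ℝ) := by linarith [ha i, hb i]
    have hLpos : 0 < L := by linarith [ha i, hb i, h1, h2]
    have hn1 : (n i : ℝ) < 1 := by
      by_contra hc
      push Not at hc
      nlinarith
    have hn2 : (-1 : ℝ) < n i := by
      by_contra hc
      push Not at hc
      nlinarith
    have hn1' : n i < 1 := by exact_mod_cast hn1
    have hn2' : -1 < n i := by exact_mod_cast hn2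
    omega
  -- so the scatterer itself is in the padded box
  refine hempty j fun i => ?_
  have h := hcoord i
  rw [hn i, Int.cast_zero, mul_zero, sub_zero, abs_le] at h
  obtain ⟨h1, h2⟩ := hxa i
  constructor <;> linarith [h.1, h.2]

/-- A translate `a + (0,s)³` whose `R₀`-padding (with `R₀ ≥ 0`) fits in `[0,L]³` lies in the open box
`(0,L)³`. [folklore] -/
theorem translate_box_subset_box {R₀ : ℝ} (hR₀ : 0 ≤ R₀) {a : Space} {s : ℝ}
    (ha : ∀ i, 0 ≤ a i - R₀) (hb : ∀ i, a i + s + R₀ ≤ L) :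
    {x : Space | x - a ∈ box s} ⊆ box L := by
  intro x hx i
  have h := hx i
  simp only [PiLp.sub_apply, Set.mem_Ioo] at h
  constructor <;> linarith [ha i, hb i, h.1, h.2]

/-- **A void bounds the quenched ground-state energy** (the "empty ball" step of the informal proof
of `FrozenBathNoBEC`). If the padded box around `a + (0,s)³` lies in `[0,L]³` and contains no
scatterer, then the infimum of the quenched one-body energy over periodic trial states is at most
the free Dirichlet ground-state energy of the box of side `s`, i.e. `s⁻² E₀(1,1)`: translate a
Dirichlet state of `(0,s)³` to the void and periodise it; on the cell its quenched energy is its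
kinetic energy. [cite: LSSY2005, Ch. 2, after (2.2)] -/
theorem iInf_quenched_le_of_void {v : ℝ → ℝ≥0∞} {R₀ : ℝ} (hv0 : ∀ r, R₀ < r → v r = 0)
    (hR₀ : 0 ≤ R₀) (hL : 0 < L) {M : ℕ} {Y : Config M} (hY : ∀ j, Y j ∈ cell L) {a : Space}
    {s : ℝ} (hs : 0 < s) (ha : ∀ i, 0 ≤ a i - R₀) (hb : ∀ i, a i + s + R₀ ≤ L)
    (hempty : ∀ j, ¬ ∀ i, a i - R₀ < Y j i ∧ Y j i < a i + s + R₀) :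
    (⨅ θ : PeriodicTrialState 1 L, ∫⁻ X in cellN 1 L, kineticDensity θ.ψ X +
        (∑ j, periodizedPotential v L (X 0 - Y j)) * (‖θ.ψ X‖₊ : ℝ≥0∞) ^ 2) ≤
      ENNReal.ofReal (s ^ 2)⁻¹ * groundStateEnergy 0 1 1 := by
  have hgs : groundStateEnergy 0 1 s = ENNReal.ofReal (s ^ 2)⁻¹ * groundStateEnergy 0 1 1 := by
    have h := Literature.MathematicalPhysics.QuantumManyBody.JelliumBoseGas.groundStateEnergy_dilate 0 1 1 hs
    rwa [scalePotential_zero, mul_one] at h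
  rw [← hgs, groundStateEnergy]
  refine le_iInf fun Ψ => ?_
  have hsub : {x : Space | x - a ∈ box s} ⊆ box L := translate_box_subset_box hR₀ ha hb
  set Φ₀ : SupportedState 1 {x : Space | x - a ∈ box s} := Ψ.toSupported.translate a with hΦ₀
  set Θ : PeriodicTrialState 1 L := (Φ₀.mono hsub).toTrialState.toPeriodic hL le_rfl with hΘ
  have hΘψ : Θ.ψ = periodize L Φ₀.ψ := rfl
  refine (iInf_le _ Θ).trans ?_
  calc ∫⁻ X in cellN 1 L, kineticDensity Θ.ψ X +
        (∑ j, periodizedPotential v L (X 0 - Y j)) * (‖Θ.ψ X‖₊ : ℝ≥0∞) ^ 2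
      = ∫⁻ X in boxN 1 L, kineticDensity Θ.ψ X +
        (∑ j, periodizedPotential v L (X 0 - Y j)) * (‖Θ.ψ X‖₊ : ℝ≥0∞) ^ 2 :=
        (setLIntegral_congr (boxN_ae_eq_cellN 1 L)).symm
    _ = ∫⁻ X in boxN 1 L, kineticDensity Φ₀.ψ X +
        (∑ j, periodizedPotential v L (X 0 - Y j)) * (‖Φ₀.ψ X‖₊ : ℝ≥0∞) ^ 2 := by
        refine setLIntegral_congr_fun (measurableSet_boxN 1 L) fun X hX => ?_
        rw [hΘψ, kineticDensity_periodize_of_mem_boxN hL Φ₀.ψ hX,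
          periodize_of_mem_cellN hL Φ₀.ψ (boxN_subset_cellN le_rfl hX)]
    _ = ∫⁻ X in boxN 1 L, kineticDensity Φ₀.ψ X := by
        refine lintegral_congr fun X => ?_
        by_cases hX : X 0 - a ∈ box s
        · rw [quenched_eq_zero_of_void hv0 hY ha hb hempty hX, zero_mul, add_zero]
        · rw [Φ₀.eq_zero X ⟨0, hX⟩]
          simp
    _ ≤ ∫⁻ X, kineticDensity Φ₀.ψ X := setLIntegral_le_lintegral _ _
    _ = rawEnergy 0 Φ₀.ψ := by
        unfold rawEnergy
        refine lintegral_congr fun X => ?_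
        simp [interaction]
    _ = rawEnergy 0 Ψ.ψ := rawEnergy_translate 0 a Ψ.toSupported
    _ = energy 0 Ψ := (energy_eq_rawEnergy 0 Ψ).symm

end Summit.AtomisticToContinuum.BoseEinsteinCondensation.Theorems.FrozenBath

end
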